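import Summits.CriticalPhenomena.PercolationContinuityZ3.Theorems.Transplant.FKConnectivityAllQPat3SlotReach
import Summits.CriticalPhenomena.PercolationContinuityZ3.Theorems.Transplant.FKConnectivityAllQPat3ThetaJoin
import Summits.CriticalPhenomena.PercolationContinuityZ3.Theorems.Transplant.FKConnectivityAllQAntipodalMinorDefs
import HarnessLib

/-!
# Connectivity correlation inequalities for `φ_{w,q}`, every `q > 0` — ATTACHING ONE PIECE ALONG TWO NAMED POINTS: the
# connectivity of a family of named points after a two-point gluing is a computable function of the connectivity before and of
# the piece's pattern (census g39 §11 (ii): «union–find over the named points», the step of the skeleton-gluing engine)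

Definitions + theorems file (`--supports stmt-CriticalPhenomena-4575`), census lineage (gen 40) of LANE 2's FK sub-programme; builds on
p205010 (kernel theorem, internal audit signed; external expert review pending).  No named facts, no sorries; standard axioms.

SETTING.  Host edges `E₁` on `V₁`; a piece `E₂` on `V₂` glued along `u ≠ v` only (`V₁ ∩ V₂ ⊆ {u, v}`); a family of NAMED POINTS
`p : ι → V`, each on the host side (off `V₂`, or `u`, or `v`) or equal to the piece's inner mark `m ∈ V₂ \ V₁`; a Boolean
matrix `R : ι → ι → Bool` recording the connectivity of the named points in the host configuration `γ₁` (the not-yet-attached mark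
`m` is isolated there).
* `FK.reachable_union_mark` — a host point reaches the inner mark `m` of the piece in `γ₁ ∪ γ₂` iff it reaches `u` (in the union)
  and `u ↔ m` inside the piece, or the same through `v`.
* `FK.attachBit R i j c` / `FK.attachPat R i j k P` (DEFINITIONS, computable) — the connectivity matrix after gluing an UNMARKED piece
  with bit `c = 1{u ↔ v in γ₂}` at the named points `i, j` (`p i = u`, `p j = v`), resp. a MARKED piece with pattern
  `P = pat3 γ₂ u v m` at `i, j, k` (`p k = m`).
* **`FK.attachBit_iff`**, **`FK.attachPat_iff`** — SOUNDNESS: if `R` is the connectivity of `p` in `γ₁` then `attachBit …` /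
  `attachPat …` is the connectivity of `p` in `γ₁ ∪ γ₂` (by `FK.reachable_union_free` of `…Pat3SlotReach` and
  `FK.reachable_union_mark`); under the configuration sum: `FK.sum_attachPat` / `FK.sum_attachBit` / `FK.sum_attachPatC` (piece
  read as a minor `(E₂, C₂)`) — Fubini plus the step, for ANY summand of (level, matrix, matrix).  Iterating piece by piece from the edgeless skeleton (discrete matrix) computes the pattern of any
  shape — K₄-skeleton leaves VEE\*/EEE, wheel and torso leaves — with the level corrections read off as the indicators
  `R i j ∧ P.xy` of each step (fk-2's `clusterCount_parallel`), exactly as g36's `join3`/`corr3` do for the THETA shape.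
[cite: Grimmett2006, §1.4 eq. (1.20) (p. 15); §3.8 (pp. 61–62)]
-/

namespace Summit.CriticalPhenomena.PercolationContinuityZ3.Theorems

namespace FK

open SimpleGraph Literature.Probability.LatticeModels Literature.Probability.Percolation
open scoped Classical

variable {V : Type*}

/-! ### A host point and the inner mark of the piece -/

section Mark

variable {E₁ E₂ : Finset (Sym2 V)} {V₁ V₂ : Set V} {u v : V}

/-- **A host point reaches the piece's inner mark through `u` or through `v`**: for `a` on the host side and `m` inside the
piece (off `V₁`), `a ↔ m` in `γ₁ ∪ γ₂` iff (`a ↔ u` in `γ₁ ∪ γ₂` and `u ↔ m` in `γ₂`) or (`a ↔ v` in `γ₁ ∪ γ₂` and `v ↔ m` in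
`γ₂`). [folklore] -/
theorem reachable_union_mark (h₁ : ∀ e ∈ (↑E₁ : Set (Sym2 V)), ∀ z ∈ e, z ∈ V₁)
    (h₂ : ∀ e ∈ (↑E₂ : Set (Sym2 V)), ∀ z ∈ e, z ∈ V₂) (hS : V₁ ∩ V₂ ⊆ {u, v}) {a m : V}
    (ha : a ∈ V₂ → a = u ∨ a = v) (hm : m ∉ V₁) (hma : m ≠ a)
    {γ₁ γ₂ : Finset (Sym2 V)} (g₁ : γ₁ ⊆ E₁) (g₂ : γ₂ ⊆ E₂) :
    (openGraph (↑(γ₁ ∪ γ₂) : BondConfig V)).Reachable a m ↔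
      ((openGraph (↑(γ₁ ∪ γ₂) : BondConfig V)).Reachable a u ∧ (openGraph (↑γ₂ : BondConfig V)).Reachable u m) ∨
        ((openGraph (↑(γ₁ ∪ γ₂) : BondConfig V)).Reachable a v ∧ (openGraph (↑γ₂ : BondConfig V)).Reachable v m) := by
  have hω₁ : (↑γ₁ : Set (Sym2 V)) ⊆ ↑E₁ := Finset.coe_subset.2 g₁
  have hω₂ : (↑γ₂ : Set (Sym2 V)) ⊆ ↑E₂ := Finset.coe_subset.2 g₂
  have l₂ : ∀ {p q : V}, (openGraph (↑γ₂ : BondConfig V)).Reachable p q →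
      (openGraph (↑(γ₁ ∪ γ₂) : BondConfig V)).Reachable p q := fun h => by
    rw [Finset.coe_union]; exact GZGluing.reachable_union_of_side (Or.inr h)
  refine ⟨fun h => ?_, ?_⟩
  · -- split the reversed walk `m → a` at the separator `{u, v, a}`
    rw [Finset.coe_union] at h
    obtain ⟨p⟩ := h.symm
    have hS' : V₂ ∩ V₁ ⊆ ({u, v, a} : Set V) := fun z hz => by
      rcases hS ⟨hz.2, hz.1⟩ with h | h
      · exact Or.inl h
      · exact Or.inr (Or.inl h)
    have p' : (openGraph ((↑γ₂ : Set (Sym2 V)) ∪ ↑γ₁)).Walk m a := by rw [Set.union_comm]; exact p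
    obtain ⟨s', hs'S, hside, hchain⟩ := GZGluing.walk_split h₂ h₁ hS' hω₂ hω₁ p' (by simp)
    -- the first segment lies in `γ₂` (the mark is off `V₁`)
    have hfirst : (openGraph (↑γ₂ : BondConfig V)).Reachable m s' := by
      rcases hside with hs | hs
      · exact hs
      · rcases eq_or_ne m s' with hms | hms
        · rw [← hms]
        · exact absurd (GZGluing.mem_of_reachable_ne h₁ hω₁ hs hms) hm
    -- the chain of hops is a union walk from `s'` to `a`
    have hA : ∀ b c, b ∈ ({z | (openGraph ((↑γ₂ : Set (Sym2 V)) ∪ ↑γ₁)).Reachable s' z} : Set V) →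
        (b ∈ ({u, v, a} : Set V) ∧ c ∈ ({u, v, a} : Set V) ∧
          ((openGraph (↑γ₂ : BondConfig V)).Reachable b c ∨ (openGraph (↑γ₁ : BondConfig V)).Reachable b c)) →
        c ∈ ({z | (openGraph ((↑γ₂ : Set (Sym2 V)) ∪ ↑γ₁)).Reachable s' z} : Set V) :=
      fun b c hb hbc => Reachable.trans hb (GZGluing.reachable_union_of_side hbc.2.2)
    have hrest : (openGraph ((↑γ₂ : Set (Sym2 V)) ∪ ↑γ₁)).Reachable s' a :=
      GZGluing.reflTransGen_mem hA hchain (Reachable.refl _)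
    rw [Set.union_comm, ← Finset.coe_union] at hrest
    rcases hs'S with h' | h' | h'
    · rw [h'] at hfirst hrest; exact Or.inl ⟨hrest.symm, hfirst.symm⟩
    · rw [h'] at hfirst hrest; exact Or.inr ⟨hrest.symm, hfirst.symm⟩
    · -- `s' = a`: the whole walk lies in the piece, so `a ∈ {u, v}`
      rw [Set.mem_singleton_iff] at h'
      rw [h'] at hfirst
      have ha2 : a ∈ V₂ := GZGluing.mem_of_reachable_ne h₂ hω₂ hfirst.symm hma.symm
      rcases ha ha2 with hau | hav
      · rw [hau] at hfirst ⊢; exact Or.inl ⟨Reachable.refl _, hfirst.symm⟩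
      · rw [hav] at hfirst ⊢; exact Or.inr ⟨Reachable.refl _, hfirst.symm⟩
  · rintro (⟨h1, h2⟩ | ⟨h1, h2⟩)
    · exact h1.trans (l₂ h2)
    · exact h1.trans (l₂ h2)

/-- `FK.reachable_union_mark` read from the mark's side. [folklore] -/
theorem reachable_union_mark_left (h₁ : ∀ e ∈ (↑E₁ : Set (Sym2 V)), ∀ z ∈ e, z ∈ V₁)
    (h₂ : ∀ e ∈ (↑E₂ : Set (Sym2 V)), ∀ z ∈ e, z ∈ V₂) (hS : V₁ ∩ V₂ ⊆ {u, v}) {a m : V}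
    (ha : a ∈ V₂ → a = u ∨ a = v) (hm : m ∉ V₁) (hma : m ≠ a)
    {γ₁ γ₂ : Finset (Sym2 V)} (g₁ : γ₁ ⊆ E₁) (g₂ : γ₂ ⊆ E₂) :
    (openGraph (↑(γ₁ ∪ γ₂) : BondConfig V)).Reachable m a ↔
      ((openGraph (↑(γ₁ ∪ γ₂) : BondConfig V)).Reachable a u ∧ (openGraph (↑γ₂ : BondConfig V)).Reachable u m) ∨
        ((openGraph (↑(γ₁ ∪ γ₂) : BondConfig V)).Reachable a v ∧ (openGraph (↑γ₂ : BondConfig V)).Reachable v m) := by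
  rw [SimpleGraph.reachable_comm]
  exact reachable_union_mark h₁ h₂ hS ha hm hma g₁ g₂

end Mark

/-! ### The attachment step on a connectivity matrix of named points -/

section Attach

variable {ι : Type*}

/-- **Gluing an UNMARKED piece** with bit `c = 1{u ↔ v in the piece}` at the named points `i, j`: two named points are joined
afterwards iff they were joined, or they are joined to the two ends of the open passage. [folklore] -/
def attachBit (R : ι → ι → Bool) (i j : ι) (c : Bool) : ι → ι → Bool :=
  fun a b => R a b || (c && (R a i && R j b || R a j && R i b))

/-- **Gluing a MARKED piece** with pattern `P` on `(u, v, m)` at the named points `i, j` (the terminals) and `k` (the name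
reserved for the mark, isolated before the gluing): host points as in `attachBit` with the bit `P.xy`; a host point reaches the
mark through `u` (`P.xs`) or through `v` (`P.ys`). [folklore] -/
def attachPat (R : ι → ι → Bool) (i j k : ι) (P : Pat3) : ι → ι → Bool :=
  fun a b => attachBit R i j P.xy a b ||
    (R k b && (P.xs && attachBit R i j P.xy a i || P.ys && attachBit R i j P.xy a j)) ||
    (R a k && (P.xs && attachBit R i j P.xy i b || P.ys && attachBit R i j P.xy j b))

/-- Propositional bookkeeping for `attachPat_iff`, two host points. [folklore] -/
theorem attach_prop_host (R c Au Av Bu Bv : Prop) :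
    (R ∨ c ∧ (Au ∧ Bv ∨ Av ∧ Bu)) ↔ (R ∨ Au ∧ c ∧ Bv ∨ Av ∧ c ∧ Bu) := by tauto

/-- Propositional bookkeeping for `attachPat_iff`, host point to mark. [folklore] -/
theorem attach_prop_mark (xs ys Au Av c Rvu : Prop) :
    (xs ∧ (Au ∨ c ∧ (Au ∧ Rvu ∨ Av)) ∨ ys ∧ (Av ∨ c ∧ (Au ∨ Av ∧ Rvu))) ↔
      ((Au ∨ Au ∧ c ∧ Rvu ∨ Av ∧ c) ∧ xs ∨ (Av ∨ Au ∧ c ∨ Av ∧ c ∧ Rvu) ∧ ys) := by tauto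

/-- Propositional bookkeeping for `attachPat_iff`, mark to host point. [folklore] -/
theorem attach_prop_mark' (xs ys Bu Bv c Rvu : Prop) :
    (xs ∧ (Bu ∨ c ∧ (Bv ∨ Rvu ∧ Bu)) ∨ ys ∧ (Bv ∨ c ∧ (Rvu ∧ Bv ∨ Bu))) ↔
      ((Bu ∨ Bu ∧ c ∧ Rvu ∨ Bv ∧ c) ∧ xs ∨ (Bv ∨ Bu ∧ c ∨ Bv ∧ c ∧ Rvu) ∧ ys) := by tauto

variable {E₁ E₂ : Finset (Sym2 V)} {V₁ V₂ : Set V} {u v : V} {p : ι → V} {R : ι → ι → Bool} {γ₁ γ₂ : Finset (Sym2 V)}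

/-- **Soundness of `attachBit`**: if `R` records the connectivity of the named points `p` (all on the host side) in `γ₁`, then
`attachBit R i j 1{u ↔ v in γ₂}` records their connectivity in `γ₁ ∪ γ₂`. [folklore] -/
theorem attachBit_iff (h₁ : ∀ e ∈ (↑E₁ : Set (Sym2 V)), ∀ z ∈ e, z ∈ V₁)
    (h₂ : ∀ e ∈ (↑E₂ : Set (Sym2 V)), ∀ z ∈ e, z ∈ V₂) (hS : V₁ ∩ V₂ ⊆ {u, v})
    (hp : ∀ a, p a ∈ V₂ → p a = u ∨ p a = v) {i j : ι} (hi : p i = u) (hj : p j = v)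
    (hR : ∀ a b, R a b = true ↔ (openGraph (↑γ₁ : BondConfig V)).Reachable (p a) (p b))
    (g₁ : γ₁ ⊆ E₁) (g₂ : γ₂ ⊆ E₂) (a b : ι) :
    attachBit R i j (conn γ₂ u v) a b = true ↔ (openGraph (↑(γ₁ ∪ γ₂) : BondConfig V)).Reachable (p a) (p b) := by
  rw [reachable_union_free h₁ h₂ hS (hp a) (hp b) g₁ g₂]
  unfold attachBit
  simp only [Bool.or_eq_true, Bool.and_eq_true, hR, conn_iff, hi, hj]
  tauto

/-- **Soundness of `attachPat`**: if `R` records the connectivity of the named points `p` in `γ₁` — host-side points and the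
name `k` of the piece's inner mark `m ∉ V₁` — then `attachPat R i j k (pat3 γ₂ u v m)` records their connectivity in
`γ₁ ∪ γ₂`. [folklore] -/
theorem attachPat_iff (h₁ : ∀ e ∈ (↑E₁ : Set (Sym2 V)), ∀ z ∈ e, z ∈ V₁)
    (h₂ : ∀ e ∈ (↑E₂ : Set (Sym2 V)), ∀ z ∈ e, z ∈ V₂) (hS : V₁ ∩ V₂ ⊆ {u, v}) {m : V} (hm : m ∉ V₁)
    (hmu : m ≠ u) (hmv : m ≠ v)
    (hp : ∀ a, p a ∈ V₂ → p a = u ∨ p a = v ∨ p a = m) {i j k : ι} (hi : p i = u) (hj : p j = v) (hk : p k = m)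
    (hR : ∀ a b, R a b = true ↔ (openGraph (↑γ₁ : BondConfig V)).Reachable (p a) (p b))
    (g₁ : γ₁ ⊆ E₁) (g₂ : γ₂ ⊆ E₂) (a b : ι) :
    attachPat R i j k (pat3 γ₂ u v m) a b = true ↔ (openGraph (↑(γ₁ ∪ γ₂) : BondConfig V)).Reachable (p a) (p b) := by
  have hω₁ : (↑γ₁ : Set (Sym2 V)) ⊆ ↑E₁ := Finset.coe_subset.2 g₁
  -- in the host, only `m` itself reaches `m`
  have iso : ∀ x : V, (openGraph (↑γ₁ : BondConfig V)).Reachable x m ↔ x = m := fun x =>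
    ⟨fun h => by_contra fun hne => hm (GZGluing.mem_of_reachable_ne h₁ hω₁ h.symm (Ne.symm hne)), fun h => by rw [h]⟩
  have iso' : ∀ x : V, (openGraph (↑γ₁ : BondConfig V)).Reachable m x ↔ x = m := fun x => by
    rw [SimpleGraph.reachable_comm]; exact iso x
  -- host-side points
  have hp' : ∀ c, p c ≠ m → (p c ∈ V₂ → p c = u ∨ p c = v) := fun c hc h => by
    rcases hp c h with h' | h' | h'
    · exact Or.inl h'
    · exact Or.inr h'
    · exact absurd h' hc
  have huV : u ∈ V₂ → u = u ∨ u = v := fun _ => Or.inl rfl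
  have hvV : v ∈ V₂ → v = u ∨ v = v := fun _ => Or.inr rfl
  -- symmetric / reflexive atoms of the host connectivity, for the propositional bookkeeping
  have ruu : (openGraph (↑γ₁ : BondConfig V)).Reachable u u := Reachable.refl _
  have rvv : (openGraph (↑γ₁ : BondConfig V)).Reachable v v := Reachable.refl _
  have suv : (openGraph (↑γ₁ : BondConfig V)).Reachable u v ↔ (openGraph (↑γ₁ : BondConfig V)).Reachable v u :=
    SimpleGraph.reachable_comm
  have sbu : (openGraph (↑γ₁ : BondConfig V)).Reachable (p b) u ↔ (openGraph (↑γ₁ : BondConfig V)).Reachable u (p b) :=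
    SimpleGraph.reachable_comm
  have sbv : (openGraph (↑γ₁ : BondConfig V)).Reachable (p b) v ↔ (openGraph (↑γ₁ : BondConfig V)).Reachable v (p b) :=
    SimpleGraph.reachable_comm
  unfold attachPat attachBit
  simp only [Bool.or_eq_true, Bool.and_eq_true, hR, hi, hj, hk, pat3_xy_iff, pat3_xs_iff, pat3_ys_iff]
  by_cases ham : p a = m <;> by_cases hbm : p b = m
  · -- both names denote the mark
    rw [ham, hbm]
    simp only [iso, iso', hmu.symm, hmv.symm, true_or, true_iff]
    exact Reachable.refl _
  · -- `p a = m`, `p b` on the host side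
    rw [ham, reachable_union_mark_left h₁ h₂ hS (hp' b hbm) hm (Ne.symm hbm) g₁ g₂,
      reachable_union_free h₁ h₂ hS (hp' b hbm) huV g₁ g₂, reachable_union_free h₁ h₂ hS (hp' b hbm) hvV g₁ g₂]
    simp only [iso, iso', hmu.symm, hmv.symm, hbm, true_and, and_true, false_and, and_false, or_false, false_or, ruu, rvv]
    rw [sbu, sbv, suv]
    exact attach_prop_mark' _ _ _ _ _ _
  · -- `p a` on the host side, `p b = m`
    rw [hbm, reachable_union_mark h₁ h₂ hS (hp' a ham) hm (Ne.symm ham) g₁ g₂,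
      reachable_union_free h₁ h₂ hS (hp' a ham) huV g₁ g₂, reachable_union_free h₁ h₂ hS (hp' a ham) hvV g₁ g₂]
    simp only [iso, hmu.symm, hmv.symm, ham, true_and, and_true, and_false, or_false, false_or, ruu, rvv]
    rw [suv]
    exact attach_prop_mark _ _ _ _ _ _
  · -- both on the host side
    rw [reachable_union_free h₁ h₂ hS (hp' a ham) (hp' b hbm) g₁ g₂]
    simp only [iso, iso', ham, hbm, false_and, or_false]
    exact attach_prop_host _ _ _ _ _ _

end Attach

/-! ### The attachment step under a sum over configurations (Fubini + the step) -/

section Sum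

variable {ι : Type*}

/-- **Connectivity matrix** of the named points `p` in the configuration `γ`: `cmat p γ a b = 1{p a ↔ p b in γ}`. [folklore] -/
noncomputable def cmat (p : ι → V) (γ : Finset (Sym2 V)) : ι → ι → Bool := fun a b => conn γ (p a) (p b)

/-- Entries of the connectivity matrix. [folklore] -/
theorem cmat_iff (p : ι → V) (γ : Finset (Sym2 V)) (a b : ι) :
    cmat p γ a b = true ↔ (openGraph (↑γ : BondConfig V)).Reachable (p a) (p b) := conn_iff γ (p a) (p b)

/-- The EDGELESS host: the connectivity matrix of the empty configuration is the equality pattern of the names. [folklore] -/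
theorem cmat_empty (p : ι → V) : cmat p ∅ = fun a b => decide (p a = p b) := by
  funext a b
  rw [← Bool.coe_iff_coe, cmat_iff, decide_eq_true_iff]
  have : openGraph (↑(∅ : Finset (Sym2 V)) : BondConfig V) = ⊥ := by rw [Finset.coe_empty, openGraph, fromEdgeSet_empty]
  rw [this, reachable_bot]

/-- **Reading the three-mark pattern off the matrix**: `pat3 γ x y s` from the entries at the names of `x, y, s`. [folklore] -/
theorem pat3_eq_ofBits_cmat (p : ι → V) (γ : Finset (Sym2 V)) {ix iy is : ι} {x y s : V} (hx : p ix = x) (hy : p iy = y)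
    (hs : p is = s) : pat3 γ x y s = Pat3.ofBits (cmat p γ ix iy) (cmat p γ ix is) (cmat p γ iy is) := by
  rw [pat3_eq_ofBits]; unfold cmat; rw [hx, hy, hs]

variable {E₁ E₂ : Finset (Sym2 V)} {V₁ V₂ : Set V} {u v : V} {p : ι → V}

/-- **One marked piece, matrices**: the connectivity matrix of `γ₁ ∪ γ₂` is `attachPat` of that of `γ₁`. [folklore] -/
theorem cmat_union_eq_attachPat (h₁ : ∀ e ∈ (↑E₁ : Set (Sym2 V)), ∀ z ∈ e, z ∈ V₁)
    (h₂ : ∀ e ∈ (↑E₂ : Set (Sym2 V)), ∀ z ∈ e, z ∈ V₂) (hS : V₁ ∩ V₂ ⊆ {u, v}) {m : V} (hm : m ∉ V₁) (hmu : m ≠ u)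
    (hmv : m ≠ v) (hp : ∀ a, p a ∈ V₂ → p a = u ∨ p a = v ∨ p a = m) {i j k : ι} (hi : p i = u) (hj : p j = v)
    (hk : p k = m) {γ₁ γ₂ : Finset (Sym2 V)} (g₁ : γ₁ ⊆ E₁) (g₂ : γ₂ ⊆ E₂) :
    cmat p (γ₁ ∪ γ₂) = attachPat (cmat p γ₁) i j k (pat3 γ₂ u v m) := by
  funext a b
  rw [← Bool.coe_iff_coe, cmat_iff, attachPat_iff h₁ h₂ hS hm hmu hmv hp hi hj hk (cmat_iff p _) g₁ g₂ a b]

/-- **One unmarked piece, matrices**: the connectivity matrix of `γ₁ ∪ γ₂` is `attachBit` of that of `γ₁`. [folklore] -/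
theorem cmat_union_eq_attachBit (h₁ : ∀ e ∈ (↑E₁ : Set (Sym2 V)), ∀ z ∈ e, z ∈ V₁)
    (h₂ : ∀ e ∈ (↑E₂ : Set (Sym2 V)), ∀ z ∈ e, z ∈ V₂) (hS : V₁ ∩ V₂ ⊆ {u, v})
    (hp : ∀ a, p a ∈ V₂ → p a = u ∨ p a = v) {i j : ι} (hi : p i = u) (hj : p j = v)
    {γ₁ γ₂ : Finset (Sym2 V)} (g₁ : γ₁ ⊆ E₁) (g₂ : γ₂ ⊆ E₂) :
    cmat p (γ₁ ∪ γ₂) = attachBit (cmat p γ₁) i j (conn γ₂ u v) := by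
  funext a b
  rw [← Bool.coe_iff_coe, cmat_iff, attachBit_iff h₁ h₂ hS hp hi hj (cmat_iff p _) g₁ g₂ a b]

variable [Fintype V]

/-- **THE ATTACHMENT STEP UNDER THE CONFIGURATION SUM (marked piece).**  For ANY summand `g` reading the level and the two
connectivity matrices (configuration / complement) of the named points: the sum over the configurations of `E₁ ∪ E₂` is the
double sum over host and piece configurations, the matrices glued by `FK.attachPat` with the piece's patterns and the level
corrected by `1{u ↔ v on both sides}` twice (fk-2's `FK.apExp_parallel`).  Peeling the pieces of a shape one by one down to the
edgeless host (`FK.cmat_empty`) computes every skeleton-gluing coefficient table of census g39 §4. [folklore] -/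
theorem sum_attachPat {β : Type*} [AddCommMonoid β] (hd : Disjoint E₁ E₂)
    (h₁ : ∀ e ∈ (↑E₁ : Set (Sym2 V)), ∀ z ∈ e, z ∈ V₁) (h₂ : ∀ e ∈ (↑E₂ : Set (Sym2 V)), ∀ z ∈ e, z ∈ V₂)
    (hS : V₁ ∩ V₂ ⊆ {u, v}) (huv : u ≠ v) {m : V} (hm : m ∉ V₁) (hmu : m ≠ u) (hmv : m ≠ v)
    (hp : ∀ a, p a ∈ V₂ → p a = u ∨ p a = v ∨ p a = m) {i j k : ι} (hi : p i = u) (hj : p j = v) (hk : p k = m)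
    (s₀ : ℕ) (g : ℕ → (ι → ι → Bool) → (ι → ι → Bool) → β) :
    ∑ γ ∈ (E₁ ∪ E₂).powerset, g (apExp (E₁ ∪ E₂) γ + 2 * Fintype.card V + s₀) (cmat p γ) (cmat p ((E₁ ∪ E₂) \ γ)) =
      ∑ γ₁ ∈ E₁.powerset, ∑ γ₂ ∈ E₂.powerset,
        g (apExp E₁ γ₁ + apExp E₂ γ₂ + (if cmat p γ₁ i j && (pat3 γ₂ u v m).xy then 1 else 0) +
            (if cmat p (E₁ \ γ₁) i j && (pat3 (E₂ \ γ₂) u v m).xy then 1 else 0) + s₀)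
          (attachPat (cmat p γ₁) i j k (pat3 γ₂ u v m)) (attachPat (cmat p (E₁ \ γ₁)) i j k (pat3 (E₂ \ γ₂) u v m)) := by
  rw [sum_powerset_union_disj hd]
  refine Finset.sum_congr rfl fun γ₁ hγ₁ => Finset.sum_congr rfl fun γ₂ hγ₂ => ?_
  have g₁ := Finset.mem_powerset.1 hγ₁
  have g₂ := Finset.mem_powerset.1 hγ₂
  -- matrices
  have mA : ∀ {δ₁ δ₂ : Finset (Sym2 V)}, δ₁ ⊆ E₁ → δ₂ ⊆ E₂ →
      cmat p (δ₁ ∪ δ₂) = attachPat (cmat p δ₁) i j k (pat3 δ₂ u v m) := fun d₁ d₂ =>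
    cmat_union_eq_attachPat h₁ h₂ hS hm hmu hmv hp hi hj hk d₁ d₂
  -- levels
  have e := apExp_parallel hd h₁ h₂ hS huv le_rfl le_rfl g₁ g₂
  rw [ite_prop_eq_ite_bool
      (p := (openGraph (↑γ₁ : BondConfig V)).Reachable u v ∧ (openGraph (↑γ₂ : BondConfig V)).Reachable u v)
      (bb := cmat p γ₁ i j && (pat3 γ₂ u v m).xy) (by rw [Bool.and_eq_true, cmat_iff, pat3_xy_iff, hi, hj]),
    ite_prop_eq_ite_bool
      (p := (openGraph (↑(E₁ \ γ₁) : BondConfig V)).Reachable u v ∧ (openGraph (↑(E₂ \ γ₂) : BondConfig V)).Reachable u v)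
      (bb := cmat p (E₁ \ γ₁) i j && (pat3 (E₂ \ γ₂) u v m).xy)
      (by rw [Bool.and_eq_true, cmat_iff, pat3_xy_iff, hi, hj])] at e
  rw [union_sdiff_union hd g₁ g₂, mA g₁ g₂, mA Finset.sdiff_subset Finset.sdiff_subset, e]
  congr 1
  ac_rfl

/-- **The attachment step under the configuration sum, marked piece read as a MINOR** (contracted set `C₂` inside the piece, open
in both members; host without contractions): as `FK.sum_attachPat` with the piece's data `(apExpC E₂ C₂ γ₂, pat3 (γ₂ ∪ C₂),
pat3 ((E₂ \ γ₂) ∪ C₂))` — the form the minors recursion (census g37) consumes. [folklore] -/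
theorem sum_attachPatC {β : Type*} [AddCommMonoid β] {C₂ : Finset (Sym2 V)} (hd : Disjoint E₁ E₂)
    (h₁ : ∀ e ∈ (↑E₁ : Set (Sym2 V)), ∀ z ∈ e, z ∈ V₁) (h₂ : ∀ e ∈ (↑(E₂ ∪ C₂) : Set (Sym2 V)), ∀ z ∈ e, z ∈ V₂)
    (hS : V₁ ∩ V₂ ⊆ {u, v}) (huv : u ≠ v) {m : V} (hm : m ∉ V₁) (hmu : m ≠ u) (hmv : m ≠ v)
    (hp : ∀ a, p a ∈ V₂ → p a = u ∨ p a = v ∨ p a = m) {i j k : ι} (hi : p i = u) (hj : p j = v) (hk : p k = m)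
    (s₀ : ℕ) (g : ℕ → (ι → ι → Bool) → (ι → ι → Bool) → β) :
    ∑ γ ∈ (E₁ ∪ E₂).powerset,
        g (apExpC (E₁ ∪ E₂) C₂ γ + 2 * Fintype.card V + s₀) (cmat p (γ ∪ C₂)) (cmat p ((E₁ ∪ E₂) \ γ ∪ C₂)) =
      ∑ γ₁ ∈ E₁.powerset, ∑ γ₂ ∈ E₂.powerset,
        g (apExp E₁ γ₁ + apExpC E₂ C₂ γ₂ + (if cmat p γ₁ i j && (pat3 (γ₂ ∪ C₂) u v m).xy then 1 else 0) +
            (if cmat p (E₁ \ γ₁) i j && (pat3 (E₂ \ γ₂ ∪ C₂) u v m).xy then 1 else 0) + s₀)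
          (attachPat (cmat p γ₁) i j k (pat3 (γ₂ ∪ C₂) u v m))
          (attachPat (cmat p (E₁ \ γ₁)) i j k (pat3 (E₂ \ γ₂ ∪ C₂) u v m)) := by
  rw [sum_powerset_union_disj hd]
  refine Finset.sum_congr rfl fun γ₁ hγ₁ => Finset.sum_congr rfl fun γ₂ hγ₂ => ?_
  have g₁ := Finset.mem_powerset.1 hγ₁
  have g₂ := Finset.mem_powerset.1 hγ₂
  have s₂ : ∀ {δ : Finset (Sym2 V)}, δ ⊆ E₂ → δ ∪ C₂ ⊆ E₂ ∪ C₂ := fun h => Finset.union_subset_union h (subset_refl _)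
  -- sets
  rw [union_sdiff_union hd g₁ g₂, Finset.union_assoc γ₁ γ₂ C₂, Finset.union_assoc (E₁ \ γ₁) (E₂ \ γ₂) C₂,
    cmat_union_eq_attachPat h₁ h₂ hS hm hmu hmv hp hi hj hk g₁ (s₂ g₂),
    cmat_union_eq_attachPat h₁ h₂ hS hm hmu hmv hp hi hj hk (Finset.sdiff_subset (t := γ₁)) (s₂ Finset.sdiff_subset)]
  -- levels: fk-2's parallel junction on both members
  have k1 := clusterCount_parallel h₁ h₂ hS (Finset.coe_subset.2 g₁) (Finset.coe_subset.2 (s₂ g₂)) huv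
  have k2 := clusterCount_parallel h₁ h₂ hS (Finset.coe_subset.2 (Finset.sdiff_subset (t := γ₁)))
    (Finset.coe_subset.2 (s₂ (Finset.sdiff_subset (t := γ₂)))) huv
  rw [ite_prop_eq_ite_bool
      (p := (openGraph (↑γ₁ : BondConfig V)).Reachable u v ∧ (openGraph (↑(γ₂ ∪ C₂) : BondConfig V)).Reachable u v)
      (bb := cmat p γ₁ i j && (pat3 (γ₂ ∪ C₂) u v m).xy) (by rw [Bool.and_eq_true, cmat_iff, pat3_xy_iff, hi, hj])] at k1
  rw [ite_prop_eq_ite_bool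
      (p := (openGraph (↑(E₁ \ γ₁) : BondConfig V)).Reachable u v ∧ (openGraph (↑(E₂ \ γ₂ ∪ C₂) : BondConfig V)).Reachable u v)
      (bb := cmat p (E₁ \ γ₁) i j && (pat3 (E₂ \ γ₂ ∪ C₂) u v m).xy)
      (by rw [Bool.and_eq_true, cmat_iff, pat3_xy_iff, hi, hj])] at k2
  have e : apExpC (E₁ ∪ E₂) C₂ (γ₁ ∪ γ₂) + 2 * Fintype.card V =
      apExp E₁ γ₁ + apExpC E₂ C₂ γ₂ + (if cmat p γ₁ i j && (pat3 (γ₂ ∪ C₂) u v m).xy then 1 else 0) +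
        (if cmat p (E₁ \ γ₁) i j && (pat3 (E₂ \ γ₂ ∪ C₂) u v m).xy then 1 else 0) := by
    unfold apExpC apExp
    rw [union_sdiff_union hd g₁ g₂, Finset.union_assoc, Finset.union_assoc, Finset.coe_union, Finset.coe_union (E₁ \ γ₁)]
    omega
  rw [e]

/-- **The attachment step under the configuration sum, UNMARKED piece** (a plain skeleton edge, or a mark-free slot): matrices
glued by `FK.attachBit` with the bits `1{u ↔ v in γ₂}`, `1{u ↔ v in E₂ \ γ₂}`. [folklore] -/
theorem sum_attachBit {β : Type*} [AddCommMonoid β] (hd : Disjoint E₁ E₂)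
    (h₁ : ∀ e ∈ (↑E₁ : Set (Sym2 V)), ∀ z ∈ e, z ∈ V₁) (h₂ : ∀ e ∈ (↑E₂ : Set (Sym2 V)), ∀ z ∈ e, z ∈ V₂)
    (hS : V₁ ∩ V₂ ⊆ {u, v}) (huv : u ≠ v) (hp : ∀ a, p a ∈ V₂ → p a = u ∨ p a = v) {i j : ι} (hi : p i = u)
    (hj : p j = v) (s₀ : ℕ) (g : ℕ → (ι → ι → Bool) → (ι → ι → Bool) → β) :
    ∑ γ ∈ (E₁ ∪ E₂).powerset, g (apExp (E₁ ∪ E₂) γ + 2 * Fintype.card V + s₀) (cmat p γ) (cmat p ((E₁ ∪ E₂) \ γ)) =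
      ∑ γ₁ ∈ E₁.powerset, ∑ γ₂ ∈ E₂.powerset,
        g (apExp E₁ γ₁ + apExp E₂ γ₂ + (if cmat p γ₁ i j && conn γ₂ u v then 1 else 0) +
            (if cmat p (E₁ \ γ₁) i j && conn (E₂ \ γ₂) u v then 1 else 0) + s₀)
          (attachBit (cmat p γ₁) i j (conn γ₂ u v)) (attachBit (cmat p (E₁ \ γ₁)) i j (conn (E₂ \ γ₂) u v)) := by
  rw [sum_powerset_union_disj hd]
  refine Finset.sum_congr rfl fun γ₁ hγ₁ => Finset.sum_congr rfl fun γ₂ hγ₂ => ?_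
  have g₁ := Finset.mem_powerset.1 hγ₁
  have g₂ := Finset.mem_powerset.1 hγ₂
  have mA : ∀ {δ₁ δ₂ : Finset (Sym2 V)}, δ₁ ⊆ E₁ → δ₂ ⊆ E₂ →
      cmat p (δ₁ ∪ δ₂) = attachBit (cmat p δ₁) i j (conn δ₂ u v) := fun d₁ d₂ =>
    cmat_union_eq_attachBit h₁ h₂ hS hp hi hj d₁ d₂
  have e := apExp_parallel hd h₁ h₂ hS huv le_rfl le_rfl g₁ g₂
  rw [ite_prop_eq_ite_bool
      (p := (openGraph (↑γ₁ : BondConfig V)).Reachable u v ∧ (openGraph (↑γ₂ : BondConfig V)).Reachable u v)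
      (bb := cmat p γ₁ i j && conn γ₂ u v) (by rw [Bool.and_eq_true, cmat_iff, conn_iff, hi, hj]),
    ite_prop_eq_ite_bool
      (p := (openGraph (↑(E₁ \ γ₁) : BondConfig V)).Reachable u v ∧ (openGraph (↑(E₂ \ γ₂) : BondConfig V)).Reachable u v)
      (bb := cmat p (E₁ \ γ₁) i j && conn (E₂ \ γ₂) u v) (by rw [Bool.and_eq_true, cmat_iff, conn_iff, hi, hj])] at e
  rw [union_sdiff_union hd g₁ g₂, mA g₁ g₂, mA Finset.sdiff_subset Finset.sdiff_subset, e]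
  congr 1
  ac_rfl

/-- **The edgeless base**: the configuration sum of the empty host is one term at level `2|V|` with the equality matrices.
[folklore] -/
theorem sum_cmat_empty {β : Type*} [AddCommMonoid β] (s₀ : ℕ) (g : ℕ → (ι → ι → Bool) → (ι → ι → Bool) → β) :
    ∑ γ ∈ (∅ : Finset (Sym2 V)).powerset, g (apExp ∅ γ + s₀) (cmat p γ) (cmat p (∅ \ γ)) =
      g (2 * Fintype.card V + s₀) (fun a b => decide (p a = p b)) (fun a b => decide (p a = p b)) := by
  rw [Finset.powerset_empty, Finset.sum_singleton, Finset.sdiff_self, cmat_empty]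
  unfold apExp
  rw [Finset.sdiff_self, Finset.coe_empty, clusterCount_empty_card, two_mul]

end Sum

end FK

end Summit.CriticalPhenomena.PercolationContinuityZ3.Theorems
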